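import Mathlib
import HarnessLib
import Summits.HubbardSuperconductivity.HubbardSuperconductivity.Theorems.KLProgrammeSWaveCascadeVarying

/-!
# Route `KLProgramme` — the s-wave-dressed Cooper cascade with ENTRYWISE tail budgets and COLUMN-TYPE sources
# (row 0′ of the K3 supplier map on the V4 engine slot: `PairLadderStepAtV4` ⇒ (B1-v2) `PairArrayAt`)

Cell gate-hubbard-kl, seat hubbard-kl-r2d-p1 (child `KLRegimeBetaSplit`); sequel to p3's `KLProgrammeSWaveCascadeVarying`
(`sWaveCascade_envelope_varying`: tails measured by `Σ_j esup T_j`).  On the V4 engine slot the one-step ladder remainder carries the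
LEG-DRESSING term `CF·(Klam U)²·#{legs of the entry crossing the slice}` (p1b's (D)), which is ENTRY-localised: every entry's own legs
cross at most `20` slices in total, but at EVERY scale some entries cross — and the columns `p` on the current shell ALWAYS do, so the
product tail `(Δ_i·diag w_i·𝒞_i)(k,k') = Σ_p Δ_i(k,p) w_i(p) 𝒞_i(p,k')` is `≍ (Klam U)²·W_i·u_i` at every scale: `Σ_i esup T_i ≍ U·c`, not
`O(U²)`.  What saves the day is the STRUCTURE of that tail: it is `u_i·(column-type array) + (quadratic in the deviation)`, and in p3's
weight-independent decomposition `𝒟 = K + row R + col C + σJ` the column channel is CONTRACTED by the repulsive s-wave resummation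
itself, `C'(1 + u_i W_i) = C − u_i·rowSum_w K' + c_i`: a column source `|c_i(s)| ≤ u_i·W_i·r` costs `sup|C_n| ≤ k_n + r` — a steady
state, not a sum over scales, uniformly in the decayed `u_i`.  The entry's own legs go to the core `K` with an ENTRYWISE budget
(`‖𝒟_0(s,t)‖ + Σ_j e_j(s,t) ≤ a` for every entry — the sup taken OUTSIDE the scale sum), and the quadratic pieces ride the implicit
Gronwall lemma (`implicit_gronwall`, coefficient `20`).

**`sWaveCascade_envelope_sources`**: weights `w_n ≥ 0` (`W_n = Σ w_n`), the exact repulsive cascade `U_{n+1} = U_n/(1 + W_n U_n)` from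
`U_0 ≥ 0`, steps `𝒞_{n+1} = 𝒞_n − 𝒞_{n+1} ∗_{w_n} 𝒞_n + (E_n + col c_n)` (`n < N`) with `‖E_n(s,t)‖ ≤ e_n(s,t) + r·W_n·esup 𝒟_n`,
`‖𝒟_0(s,t)‖ + Σ_{j<N} e_j(s,t) ≤ a` for all `(s,t)`, `‖c_n(s)‖ ≤ U_n·W_n·r`, and the smallness `8·20·(a + r)·Σ_{j<N} W_j ≤ 1`
⟹ `0 ≤ U_n ≤ U_0` and `esup (𝒞_n − U_n J) ≤ 8·(a + r)` for every `n ≤ N`.  Everything is proved; no definitions.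
-/

noncomputable section

namespace Summit.HubbardSuperconductivity.HubbardSuperconductivity.Theorems.SWaveCascade

set_option linter.dupNamespace false -- summit = problem name (single-conjunct summit), D-0017

open Finset

variable {S : Type*} [Fintype S]

/-- **The envelope of the s-wave-dressed cascade with entrywise tail budgets and column-type sources.**  See the module
docstring.  Hypotheses: `w_n ≥ 0`; `U_0 ≥ 0` and the exact cascade `U_{n+1} = U_n/(1 + W_n U_n)`; the implicit steps with tails
`E_n + col c_n`; the core tails bounded ENTRYWISE by `e_n(s,t)` plus `r·W_n·esup 𝒟_n`; the entrywise budget `a`; the column sources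
`‖c_n(s)‖ ≤ U_n·W_n·r`; the smallness `8·20·(a+r)·Σ_{j<N} W_j ≤ 1`.  Conclusion: `0 ≤ U_n ≤ U_0` and
`esup (𝒞_n − U_n J) ≤ 8·(a + r)` for all `n ≤ N`. -/
theorem sWaveCascade_envelope_sources {w : ℕ → S → ℝ} (hw : ∀ n u, 0 ≤ w n u) {𝒞 E : ℕ → S → S → ℂ} {c : ℕ → S → ℂ}
    {e : ℕ → S → S → ℝ} {U : ℕ → ℝ} {N : ℕ} {a r : ℝ}
    (hU0 : 0 ≤ U 0) (hU : ∀ n, U (n + 1) = U n / (1 + (∑ u, w n u) * U n))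
    (hstep : ∀ n < N, 𝒞 (n + 1) = 𝒞 n - wmul (w n) (𝒞 (n + 1)) (𝒞 n) + (E n + fun s _ => c n s))
    (he : ∀ n s t, 0 ≤ e n s t)
    (hE : ∀ n < N, ∀ s t, ‖E n s t‖ ≤ e n s t + r * (∑ u, w n u) * esup (𝒞 n - ((U n : ℝ) : ℂ) • onesArr))
    (ha0 : 0 ≤ a) (ha : ∀ s t, ‖𝒞 0 s t - ((U 0 : ℝ) : ℂ)‖ + ∑ j ∈ range N, e j s t ≤ a)
    (hr : 0 ≤ r) (hc : ∀ n < N, ∀ s, ‖c n s‖ ≤ U n * (∑ u, w n u) * r)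
    (hsmall : 8 * 20 * (a + r) * ∑ j ∈ range N, (∑ u, w j u) ≤ 1) :
    ∀ n ≤ N, (0 ≤ U n ∧ U n ≤ U 0) ∧ esup (𝒞 n - ((U n : ℝ) : ℂ) • onesArr) ≤ 8 * (a + r) := by
  -- the scalar cascade
  set Wn : ℕ → ℝ := fun n => ∑ u, w n u with hWn
  have hWn0 : ∀ n, 0 ≤ Wn n := fun n => sum_nonneg fun u _ => hw n u
  have hU' : ∀ n, U (n + 1) = U n / (1 + Wn n * 1 * U n) := fun n => by rw [hU n, mul_one]
  have hUn : ∀ n, 0 ≤ U n := sWave_nonneg (W := 1) zero_le_one hWn0 hU0 hU'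
  have hUle : ∀ n, U n ≤ U 0 := sWave_le_init (W := 1) zero_le_one hWn0 hU0 hU'
  have hrel : ∀ n, U (n + 1) * (1 + Wn n * U n) = U n := fun n => by
    have := sWave_relation (W := 1) zero_le_one hWn0 hU0 hU' n; rwa [mul_one] at this
  have hα'1 : ∀ n, Wn n * U (n + 1) ≤ 1 := fun n => by
    have := sWave_alpha_succ_le_one (W := 1) zero_le_one hWn0 hU0 hU' n; rwa [mul_one] at this
  -- the arrays
  set 𝒟 : ℕ → S → S → ℂ := fun n => 𝒞 n - ((U n : ℝ) : ℂ) • onesArr with h𝒟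
  set Ec : ℕ → S → S → ℂ := fun n => E n - wmul (w n) (𝒟 (n + 1)) (𝒟 n) with hEc
  set K : ℕ → S → S → ℂ := fun n => 𝒟 0 + ∑ j ∈ range n, Ec j with hK
  set q : ℕ → ℝ := fun n => ∑ j ∈ range n, (r * Wn j * esup (𝒟 j) + esup (𝒟 (j + 1)) * Wn j * esup (𝒟 j)) with hq
  set k : ℕ → ℝ := fun n => a + q n with hk
  have hq_term0 : ∀ j, 0 ≤ r * Wn j * esup (𝒟 j) + esup (𝒟 (j + 1)) * Wn j * esup (𝒟 j) := fun j =>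
    add_nonneg (mul_nonneg (mul_nonneg hr (hWn0 j)) (esup_nonneg _))
      (mul_nonneg (mul_nonneg (esup_nonneg _) (hWn0 j)) (esup_nonneg _))
  have hK_succ : ∀ n, K (n + 1) = K n + Ec n := fun n => by simp only [hK, sum_range_succ]; abel
  have hq_succ : ∀ n, q (n + 1) = q n + (r * Wn n * esup (𝒟 n) + esup (𝒟 (n + 1)) * Wn n * esup (𝒟 n)) := fun n => by
    simp only [hq, sum_range_succ]
  have hk_succ : ∀ n, k (n + 1) = k n + (r * Wn n * esup (𝒟 n) + esup (𝒟 (n + 1)) * Wn n * esup (𝒟 n)) := fun n => by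
    show a + q (n + 1) = (a + q n) + _
    rw [hq_succ]; ring
  have hk_mono : ∀ n, k n ≤ k (n + 1) := fun n => by rw [hk_succ]; linarith [hq_term0 n]
  have hq0' : ∀ n, 0 ≤ q n := fun n => sum_nonneg fun j _ => hq_term0 j
  have hk0 : ∀ n, 0 ≤ k n := fun n => add_nonneg ha0 (hq0' n)
  have hka : ∀ n, a ≤ k n := fun n => by simp only [hk]; linarith [hq0' n]
  -- the core is bounded ENTRYWISE by `k` (sup outside the scale sum)
  have hKk : ∀ n ≤ N, ∀ s t, ‖K n s t‖ ≤ k n := by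
    intro n hn s t
    have h1 : ‖K n s t‖ ≤ ‖𝒟 0 s t‖ + ∑ j ∈ range n, ‖Ec j s t‖ := by
      simp only [hK, Pi.add_apply, Finset.sum_apply]
      exact (norm_add_le _ _).trans (add_le_add le_rfl (norm_sum_le _ _))
    have h2 : ∀ j ∈ range n, ‖Ec j s t‖ ≤ e j s t + (r * Wn j * esup (𝒟 j) + esup (𝒟 (j + 1)) * Wn j * esup (𝒟 j)) := by
      intro j hj
      have hjN : j < N := lt_of_lt_of_le (mem_range.1 hj) hn
      have hw1 := hE j hjN s t
      have hw2 : ‖wmul (w j) (𝒟 (j + 1)) (𝒟 j) s t‖ ≤ esup (𝒟 (j + 1)) * Wn j * esup (𝒟 j) :=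
        (le_esup _ s t).trans (esup_wmul_le (w j) (hw j) _ _)
      calc ‖Ec j s t‖ = ‖E j s t - wmul (w j) (𝒟 (j + 1)) (𝒟 j) s t‖ := rfl
        _ ≤ ‖E j s t‖ + ‖wmul (w j) (𝒟 (j + 1)) (𝒟 j) s t‖ := norm_sub_le _ _
        _ ≤ _ := by linarith
    have h3 : ∑ j ∈ range n, ‖Ec j s t‖ ≤ ∑ j ∈ range n, e j s t + q n := by
      rw [hq, ← sum_add_distrib]; exact sum_le_sum h2
    have h4 : ∑ j ∈ range n, e j s t ≤ ∑ j ∈ range N, e j s t :=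
      sum_le_sum_of_subset_of_nonneg (range_mono hn) fun j _ _ => he j s t
    have h5 := ha s t
    have h6 : ‖𝒟 0 s t‖ = ‖𝒞 0 s t - ((U 0 : ℝ) : ℂ)‖ := by
      simp only [h𝒟, Pi.sub_apply, Pi.smul_apply, onesArr, smul_eq_mul, mul_one]
    show ‖K n s t‖ ≤ a + q n
    linarith
  -- the implicit step identity at every `n < N`
  have hstar : ∀ n < N, 𝒟 (n + 1) + ((U n : ℝ) : ℂ) • wmul (w n) (𝒟 (n + 1)) onesArr =
      𝒟 n - ((U (n + 1) : ℝ) : ℂ) • wmul (w n) onesArr (𝒟 n) + (Ec n + fun s _ => c n s) := by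
    intro n hn
    rw [step_decompose' (w n) (hstep n hn) (hrel n) rfl rfl]
    congr 1
    simp only [hEc]
    abel
  -- the row / column / scalar recursion (column channel WITH source)
  set ρ : ℕ → S → ℂ := fun n t => ∑ u, (w n u : ℂ) * K n u t with hρ
  set κ : ℕ → S → ℂ := fun n s => ∑ u, K (n + 1) s u * (w n u : ℂ) with hκ
  set F : ℕ → (S → ℂ) × (S → ℂ) × ℂ → (S → ℂ) × (S → ℂ) × ℂ := fun n X =>
    ( fun t => (((1 - U (n + 1) * Wn n : ℝ)) : ℂ) * X.1 t - ((U (n + 1) : ℝ) : ℂ) * ρ n t,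
      fun s => (X.2.1 s - ((U n : ℝ) : ℂ) * κ n s + c n s) / (((1 + U n * Wn n : ℝ)) : ℂ),
      (X.2.2 * (((1 - U (n + 1) * Wn n : ℝ)) : ℂ) - ((U (n + 1) : ℝ) : ℂ) * (∑ u, (w n u : ℂ) * X.2.1 u) -
        ((U n : ℝ) : ℂ) * (∑ u, ((((1 - U (n + 1) * Wn n : ℝ)) : ℂ) * X.1 u - ((U (n + 1) : ℝ) : ℂ) * ρ n u) * (w n u : ℂ))) /
        (((1 + U n * Wn n : ℝ)) : ℂ) ) with hF
  obtain ⟨X, hX0, hXs⟩ : ∃ X : ℕ → (S → ℂ) × (S → ℂ) × ℂ, X 0 = (0, 0, 0) ∧ ∀ n, X (n + 1) = F n (X n) :=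
    ⟨fun n => Nat.rec ((0 : S → ℂ), (0 : S → ℂ), (0 : ℂ)) F n, rfl, fun n => rfl⟩
  have hden : ∀ n, (((1 + U n * Wn n : ℝ)) : ℂ) ≠ 0 := fun n => by
    have : (0 : ℝ) < 1 + U n * Wn n := by have := mul_nonneg (hUn n) (hWn0 n); linarith
    exact_mod_cast this.ne'
  have eR : ∀ n t, (X (n + 1)).1 t =
      (((1 - U (n + 1) * Wn n : ℝ)) : ℂ) * (X n).1 t - ((U (n + 1) : ℝ) : ℂ) * ρ n t := fun n t => by rw [hXs n]
  have eC : ∀ n s, (X (n + 1)).2.1 s * (((1 + U n * Wn n : ℝ)) : ℂ) = (X n).2.1 s - ((U n : ℝ) : ℂ) * κ n s + c n s :=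
    fun n s => by rw [hXs n]; exact div_mul_cancel₀ _ (hden n)
  have eσ : ∀ n, (X (n + 1)).2.2 * (((1 + U n * Wn n : ℝ)) : ℂ) =
      (X n).2.2 * (((1 - U (n + 1) * Wn n : ℝ)) : ℂ) - ((U (n + 1) : ℝ) : ℂ) * (∑ u, (w n u : ℂ) * (X n).2.1 u) -
        ((U n : ℝ) : ℂ) * (∑ u, (X (n + 1)).1 u * (w n u : ℂ)) := fun n => by
    have h1 : (X (n + 1)).2.2 = (F n (X n)).2.2 := by rw [hXs n]
    have h2 : ∀ u, (X (n + 1)).1 u = (F n (X n)).1 u := fun u => by rw [hXs n]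
    rw [h1]
    simp only [hF]
    rw [div_mul_cancel₀ _ (hden n)]
    congr 1
    congr 1
    exact sum_congr rfl fun u _ => by rw [h2 u]
  -- MAIN INDUCTION: decomposition + bounds (`|R| ≤ k`, `|C|, |σ| ≤ k + r`)
  have main : ∀ n ≤ N, 𝒟 n = K n + (fun _ t => (X n).1 t) + (fun s _ => (X n).2.1 s) + (X n).2.2 • onesArr ∧
      (∀ t, ‖(X n).1 t‖ ≤ k n) ∧ (∀ s, ‖(X n).2.1 s‖ ≤ k n + r) ∧ ‖(X n).2.2‖ ≤ k n + r := by
    intro n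
    induction n with
    | zero =>
      intro _
      refine ⟨?_, fun t => ?_, fun s => ?_, ?_⟩
      · funext s t; simp [hK, hX0]
      · simp [hX0, hk0 0]
      · simp only [hX0, Pi.zero_apply, norm_zero]; linarith [hk0 0]
      · simp only [hX0, norm_zero]; linarith [hk0 0]
    | succ n ih =>
      intro hn
      have hn' : n < N := Nat.lt_of_succ_le hn
      obtain ⟨hdec, hR, hC, hσ⟩ := ih hn'.le
      have hWUn : 0 ≤ U n * Wn n := mul_nonneg (hUn n) (hWn0 n)
      have hα'0 : 0 ≤ U (n + 1) * Wn n := mul_nonneg (hUn (n + 1)) (hWn0 n)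
      have hα'1' : U (n + 1) * Wn n ≤ 1 := by rw [mul_comm]; exact hα'1 n
      -- (1) the decomposition at n+1: candidate and uniqueness
      set Xc : S → S → ℂ := K (n + 1) + (fun _ t => (X (n + 1)).1 t) + (fun s _ => (X (n + 1)).2.1 s) +
        (X (n + 1)).2.2 • onesArr with hXc
      have hcand : Xc + ((U n : ℝ) : ℂ) • wmul (w n) Xc onesArr =
          𝒟 n - ((U (n + 1) : ℝ) : ℂ) • wmul (w n) onesArr (𝒟 n) + (Ec n + fun s _ => c n s) := by
        rw [hdec]
        funext s t
        simp only [hXc, Pi.add_apply, Pi.sub_apply, Pi.smul_apply, smul_eq_mul, wmul_decomp_onesArr, onesArr_wmul_decomp,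
          onesArr, mul_one, hK_succ]
        have e1 := eR n t
        have e2 := eC n s
        have e3 := eσ n
        have eκ : κ n s = ∑ u, K (n + 1) s u * (w n u : ℂ) := rfl
        have eρ : ρ n t = ∑ u, (w n u : ℂ) * K n u t := rfl
        rw [hK_succ] at eκ
        simp only [Pi.add_apply] at eκ
        have eW : (∑ u, (w n u : ℂ)) = ((Wn n : ℝ) : ℂ) := by rw [hWn]; push_cast; rfl
        rw [eW]
        rw [eκ] at e2
        rw [eρ] at e1
        push_cast at e1 e2 e3 ⊢
        linear_combination e1 + e2 + e3
      have hdiff : (𝒟 (n + 1) - Xc) + ((U n : ℝ) : ℂ) • wmul (w n) (𝒟 (n + 1) - Xc) onesArr = 0 := by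
        rw [wmul_sub_left, smul_sub]
        have := hstar n hn'
        rw [← sub_eq_zero]
        have h2 := hcand
        calc 𝒟 (n + 1) - Xc + (((U n : ℝ) : ℂ) • wmul (w n) (𝒟 (n + 1)) onesArr - ((U n : ℝ) : ℂ) • wmul (w n) Xc onesArr) - 0
            = (𝒟 (n + 1) + ((U n : ℝ) : ℂ) • wmul (w n) (𝒟 (n + 1)) onesArr) -
                (Xc + ((U n : ℝ) : ℂ) • wmul (w n) Xc onesArr) := by abel
          _ = 0 := by rw [this, h2, sub_self]
      have hdec' : 𝒟 (n + 1) = Xc := by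
        have := eq_zero_of_add_smul_wmul_onesArr (hw n) (hUn n) hdiff
        exact sub_eq_zero.1 this
      -- (2) the bounds
      have hρb : ∀ t, ‖ρ n t‖ ≤ Wn n * k n := fun t =>
        (norm_sum_mul_le' (hw n) (fun u => hKk n hn'.le u t)).trans le_rfl
      have hκb : ∀ s, ‖κ n s‖ ≤ Wn n * k (n + 1) := fun s =>
        (norm_sum_mul_le (hw n) (fun u => hKk (n + 1) hn s u)).trans le_rfl
      have hkn := hk_mono n
      have hR' : ∀ t, ‖(X (n + 1)).1 t‖ ≤ k (n + 1) := by
        intro t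
        rw [eR n t]
        refine (norm_sub_le _ _).trans ?_
        rw [norm_mul, norm_mul, Complex.norm_real, Complex.norm_real, Real.norm_eq_abs, Real.norm_eq_abs,
          abs_of_nonneg (by linarith), abs_of_nonneg (hUn (n + 1))]
        have h1 : (1 - U (n + 1) * Wn n) * ‖(X n).1 t‖ ≤ (1 - U (n + 1) * Wn n) * k n :=
          mul_le_mul_of_nonneg_left (hR t) (by linarith)
        have h2 : U (n + 1) * ‖ρ n t‖ ≤ U (n + 1) * (Wn n * k n) := mul_le_mul_of_nonneg_left (hρb t) (hUn (n + 1))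
        nlinarith
      have hC' : ∀ s, ‖(X (n + 1)).2.1 s‖ ≤ k (n + 1) + r := by
        intro s
        have e2 := eC n s
        have hnorm : ‖(X (n + 1)).2.1 s‖ * (1 + U n * Wn n) = ‖(X n).2.1 s - ((U n : ℝ) : ℂ) * κ n s + c n s‖ := by
          rw [← e2, norm_mul, Complex.norm_real, Real.norm_eq_abs, abs_of_nonneg (by linarith)]
        have hcs : ‖c n s‖ ≤ U n * Wn n * r := hc n hn' s
        have hb : ‖(X n).2.1 s - ((U n : ℝ) : ℂ) * κ n s + c n s‖ ≤
            (k (n + 1) + r) + U n * Wn n * k (n + 1) + U n * Wn n * r := by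
          refine (norm_add_le _ _).trans ?_
          refine (add_le_add (norm_sub_le _ _) le_rfl).trans ?_
          rw [norm_mul, Complex.norm_real, Real.norm_eq_abs, abs_of_nonneg (hUn n)]
          have := mul_le_mul_of_nonneg_left (hκb s) (hUn n)
          linarith [hC s]
        have hpos : 0 < 1 + U n * Wn n := by linarith
        have h' : ‖(X (n + 1)).2.1 s‖ * (1 + U n * Wn n) ≤ (k (n + 1) + r) * (1 + U n * Wn n) := by
          rw [hnorm]; refine hb.trans (le_of_eq ?_); ring
        exact le_of_mul_le_mul_right h' hpos
      have hσ' : ‖(X (n + 1)).2.2‖ ≤ k (n + 1) + r := by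
        have e3 := eσ n
        have hnorm : ‖(X (n + 1)).2.2‖ * (1 + U n * Wn n) =
            ‖(X n).2.2 * (((1 - U (n + 1) * Wn n : ℝ)) : ℂ) - ((U (n + 1) : ℝ) : ℂ) * (∑ u, (w n u : ℂ) * (X n).2.1 u) -
              ((U n : ℝ) : ℂ) * (∑ u, (X (n + 1)).1 u * (w n u : ℂ))‖ := by
          rw [← e3, norm_mul, Complex.norm_real, Real.norm_eq_abs, abs_of_nonneg (by linarith)]
        have hC_avg : ‖∑ u, (w n u : ℂ) * (X n).2.1 u‖ ≤ Wn n * (k n + r) := norm_sum_mul_le' (hw n) hC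
        have hR_avg : ‖∑ u, (X (n + 1)).1 u * (w n u : ℂ)‖ ≤ Wn n * k (n + 1) := norm_sum_mul_le (hw n) hR'
        have hb : ‖(X n).2.2 * (((1 - U (n + 1) * Wn n : ℝ)) : ℂ) - ((U (n + 1) : ℝ) : ℂ) * (∑ u, (w n u : ℂ) * (X n).2.1 u) -
              ((U n : ℝ) : ℂ) * (∑ u, (X (n + 1)).1 u * (w n u : ℂ))‖ ≤
            (k n + r) * (1 - U (n + 1) * Wn n) + U (n + 1) * (Wn n * (k n + r)) + U n * (Wn n * k (n + 1)) := by
          refine (norm_sub_le _ _).trans ?_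
          refine (add_le_add (norm_sub_le _ _) le_rfl).trans ?_
          rw [norm_mul, norm_mul, norm_mul, Complex.norm_real, Complex.norm_real, Complex.norm_real, Real.norm_eq_abs,
            Real.norm_eq_abs, Real.norm_eq_abs, abs_of_nonneg (by linarith : (0:ℝ) ≤ 1 - U (n + 1) * Wn n),
            abs_of_nonneg (hUn (n + 1)), abs_of_nonneg (hUn n)]
          have h1 : ‖(X n).2.2‖ * (1 - U (n + 1) * Wn n) ≤ (k n + r) * (1 - U (n + 1) * Wn n) :=
            mul_le_mul_of_nonneg_right hσ (by linarith)
          have h2 : U (n + 1) * ‖∑ u, (w n u : ℂ) * (X n).2.1 u‖ ≤ U (n + 1) * (Wn n * (k n + r)) :=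
            mul_le_mul_of_nonneg_left hC_avg (hUn (n + 1))
          have h3 : U n * ‖∑ u, (X (n + 1)).1 u * (w n u : ℂ)‖ ≤ U n * (Wn n * k (n + 1)) :=
            mul_le_mul_of_nonneg_left hR_avg (hUn n)
          linarith
        have hpos : 0 < 1 + U n * Wn n := by linarith
        have h' : ‖(X (n + 1)).2.2‖ * (1 + U n * Wn n) ≤ (k (n + 1) + r) * (1 + U n * Wn n) := by
          rw [hnorm]
          refine hb.trans ?_
          have hkr : 0 ≤ k n + r := add_nonneg (hk0 n) hr
          nlinarith [mul_nonneg hα'0 hkr, mul_nonneg hWUn hr]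
        exact le_of_mul_le_mul_right h' hpos
      exact ⟨by rw [hdec'], hR', hC', hσ'⟩
  -- `esup 𝒟 n ≤ 4 k n + 2 r`
  have he4 : ∀ n ≤ N, esup (𝒟 n) ≤ 4 * k n + 2 * r := by
    intro n hn
    obtain ⟨hdec, hR, hC, hσ⟩ := main n hn
    refine esup_le (fun s t => ?_) (by linarith [hk0 n])
    rw [hdec]
    simp only [Pi.add_apply, Pi.smul_apply, smul_eq_mul, onesArr, mul_one]
    have h1 := hKk n hn s t
    calc ‖K n s t + (X n).1 t + (X n).2.1 s + (X n).2.2‖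
        ≤ ‖K n s t‖ + ‖(X n).1 t‖ + ‖(X n).2.1 s‖ + ‖(X n).2.2‖ :=
          (norm_add_le _ _).trans (add_le_add ((norm_add_le _ _).trans (add_le_add (norm_add_le _ _) le_rfl)) le_rfl)
      _ ≤ 4 * k n + 2 * r := by linarith [hR t, hC s]
  -- Gronwall on `d n := k n + r`
  set d : ℕ → ℝ := fun n => k n + r with hd
  have hd0 : ∀ n, 0 ≤ d n := fun n => add_nonneg (hk0 n) hr
  have hdr : ∀ n, r ≤ d n := fun n => by simp only [hd]; linarith [hk0 n]
  have hd_mono : ∀ n, d n ≤ d (n + 1) := fun n => by simp only [hd]; linarith [hk_mono n]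
  have hdstep : ∀ n < N, d (n + 1) * (1 - 20 * Wn n * d n) ≤ d n + 0 := by
    intro n hn
    have h1 : esup (𝒟 n) ≤ 4 * d n := by have := he4 n hn.le; simp only [hd]; linarith
    have h2 : esup (𝒟 (n + 1)) ≤ 4 * d (n + 1) := by have := he4 (n + 1) (Nat.succ_le_of_lt hn); simp only [hd]; linarith
    have hinc : d (n + 1) = d n + (r * Wn n * esup (𝒟 n) + esup (𝒟 (n + 1)) * Wn n * esup (𝒟 n)) := by
      simp only [hd, hk_succ]; ring
    have h3 : r * Wn n * esup (𝒟 n) ≤ d n * Wn n * (4 * d n) := by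
      have := mul_le_mul (mul_le_mul_of_nonneg_right (hdr n) (hWn0 n)) h1 (esup_nonneg _)
        (mul_nonneg (hd0 n) (hWn0 n))
      linarith
    have h4 : esup (𝒟 (n + 1)) * Wn n * esup (𝒟 n) ≤ (4 * d (n + 1)) * Wn n * (4 * d n) :=
      mul_le_mul (mul_le_mul_of_nonneg_right h2 (hWn0 n)) h1 (esup_nonneg _)
        (mul_nonneg (by linarith [hd0 (n + 1)]) (hWn0 n))
    have h5 : d n * Wn n * (4 * d n) ≤ d (n + 1) * Wn n * (4 * d n) :=
      mul_le_mul_of_nonneg_right (mul_le_mul_of_nonneg_right (hd_mono n) (hWn0 n)) (by linarith [hd0 n])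
    nlinarith
  have hsmall' : 8 * 20 * (d 0 + ∑ j ∈ range N, (0 : ℝ)) * ∑ j ∈ range N, Wn j ≤ 1 := by
    have : d 0 = a + r := by simp [hd, hk, hq]
    rw [this, sum_const_zero, add_zero]; exact hsmall
  have hG := implicit_gronwall (d := d) (t := fun _ => 0) (b := Wn) (K := 20) (by norm_num) hd0 (fun _ => le_rfl) hWn0
    (fun n hn => by simpa [mul_assoc, mul_comm, mul_left_comm] using hdstep n hn) hsmall'
  intro n hn
  refine ⟨⟨hUn n, hUle n⟩, ?_⟩
  have hd0' : d 0 = a + r := by simp [hd, hk, hq]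
  have hGn := hG n hn
  rw [sum_const_zero, add_zero, hd0'] at hGn
  calc esup (𝒟 n) ≤ 4 * k n + 2 * r := he4 n hn
    _ ≤ 4 * d n := by simp only [hd]; linarith
    _ ≤ 8 * (a + r) := by linarith

end Summit.HubbardSuperconductivity.HubbardSuperconductivity.Theorems.SWaveCascade

end
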